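import Literature.Computability.AlgebraicComplexity.AndrewsForbes2022Prop35Infinite
import Literature.Computability.AlgebraicComplexity.AndrewsForbes2022PosCharReductions

/-!
# Andrews–Forbes 2022, Proposition 3.5 over EVERY field; discharge of Theorem 3.8 in characteristic `p`

`AndrewsForbes2022_thm_3_8_posChar_holds : AndrewsForbes2022_thm_3_8_posChar` — the positive-
characteristic bullet of [AndrewsForbes2022, Thm. 3.8] for ALL fields of characteristic `p`,
finite fields included.  The tree already reduces this bullet to the CONCLUSION of Prop. 3.5 over
the field at hand (`AndrewsForbes2022_thm_3_8_posChar_of`, `AndrewsForbes2022PosCharReductions.lean`)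
and proves Prop. 3.5 over every INFINITE field (`AndrewsForbes2022_prop_3_5_of_infinite`,
`AndrewsForbes2022Prop35Infinite.lean`; the tree's highest-weight argument evaluates polynomial
identities at field points and needs infinitely many of them).  The printed proof of Prop. 3.5
(p0020:L12–p0021:L75: Lemma 3.4's unipotent matrices with indeterminate entries, the
`(D+1)`-adic scaling, and the "approximate leading coefficient" substitution of powers of `ε`) uses
no property of the ground field, so Prop. 3.5 holds over finite fields too.  This file closes the
gap WITHOUT re-running the straightening-law proof, by a transfer of the CONCLUSION of Prop. 3.5
from the infinite field `L = F(t)` down to `F`: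

* base change `F → L = F(t)` (`RatFunc F`, infinite for every `F`): `f ∈ I^det_{n,m,r} ⊆ F[X]`
  stays nonzero and in `I^det_{n,m,r} ⊆ L[X]`, so the tree gives `c ∈ GL_{nm}(L(E))`, `q`,
  `α ∈ L^×`, `σ` with `f(c · X) = E^q α (K_σ|K_σ) + O(E^{q+1})` (`E` the border variable over `L`);
* specialisation `t ↦ ε`, `E ↦ ε^M` (`M ≫ 0`) — the paper's own "approximate leading coefficient"
  device (Lemmas 2.38–2.39: substitute powers of `ε` for auxiliary variables so that the leading
  term in a monomial order survives), here for the lexicographic order "`E`-order first, then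
  `t`-order": `L = F(t)` IS `F(ε)`, and a rational function in
  `E` over `L` that is regular at the `L`-point `E = ε^M` is evaluated there
  (`Prop35AllFields.regularSubring`, `Prop35AllFields.evalHom` — a ring homomorphism on the
  subring of `L(E)` of functions regular at the point, built on Mathlib's `RatFunc.eval`);
* valuation bookkeeping (`Prop35AllFields.eventually_v_eval_X_pow`,
  `Prop35AllFields.eventually_regular_and_v_eval`): for a nonzero polynomial / rational function
  `P` in `E` over `L = F(ε)` and `M` large, `P(ε^M) ≠ 0` and
  `ord_ε P(ε^M) = M · ord_E P + (constant)`; hence the error `O(E^{q+1})` becomes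
  `O(ε^{Mq + κ + 1})` for `M ≫ 0`, where `α = α' ε^κ + O(ε^{κ+1})`, `α' ∈ F^×`
  (`Prop35AllFields.exists_leading_coeff`), and `f(c(ε, ε^M) · X) = ε^{Mq+κ} α' (K_σ|K_σ) +
  O(ε^{Mq+κ+1})` with `c(ε, ε^M)` invertible over `F(ε)` — Prop. 3.5 over `F`
  (`AndrewsForbes2022_prop_3_5_of_field`).

No new definitions of mathematical content beyond the two proof devices above; no new named facts
(net debt `−1`).  Honest framing: a discharge of a typed literature statement; VP ≠ VNP is NOT
proved and nothing here is progress on it.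

## References
* [AndrewsForbes2022] R. Andrews, M. A. Forbes, *Ideals, determinants, and straightening*,
  STOC 2022, arXiv:2112.00792 — Prop. 3.5 (p0021:L41, no hypothesis on the field; proof
  p0021:L49–p0022:L12 with Lemma 3.4, p0020:L16), Lemmas 2.38–2.39 (p0017:L56–p0018:L45, the
  `x_i ↦ ε^{d_i}` approximation of a leading coefficient), Thm. 3.8 third bullet (p0023:L57, proof
  p0024:L40–L45).
-/

noncomputable section

open Polynomial WithZero Filter
open scoped RatFunc

namespace Literature.Computability.AlgebraicComplexity

namespace Prop35AllFields

variable {K : Type*} [Field K]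

/-! ### Rational functions regular at a point, and evaluation there -/

/-- The subring of `K(E)` of rational functions REGULAR at the point `a ∈ K` (reduced denominator
nonvanishing at `a`); the device through which the specialisation `E ↦ ε^M` of the proof of
`AndrewsForbes2022_prop_3_5_of_field` acts as a ring homomorphism. [folklore] -/
def regularSubring (a : K) : Subring (RatFunc K) where
  carrier := {x | Polynomial.eval₂ (RingHom.id K) a (RatFunc.denom x) ≠ 0}
  mul_mem' {x y} hx hy := by
    simp only [Set.mem_setOf_eq] at hx hy ⊢
    intro hxy
    have := Polynomial.eval₂_eq_zero_of_dvd_of_eval₂_eq_zero (RingHom.id K) a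
      (RatFunc.denom_mul_dvd x y) hxy
    rw [Polynomial.eval₂_mul] at this
    rcases mul_eq_zero.mp this with h | h <;> contradiction
  one_mem' := by simp
  add_mem' {x y} hx hy := by
    simp only [Set.mem_setOf_eq] at hx hy ⊢
    intro hxy
    have := Polynomial.eval₂_eq_zero_of_dvd_of_eval₂_eq_zero (RingHom.id K) a
      (RatFunc.denom_add_dvd x y) hxy
    rw [Polynomial.eval₂_mul] at this
    rcases mul_eq_zero.mp this with h | h <;> contradiction
  zero_mem' := by simp
  neg_mem' {x} hx := by
    simp only [Set.mem_setOf_eq] at hx ⊢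
    have hneg : -x = algebraMap K[X] (RatFunc K) (-1) * x := by simp
    rw [hneg]
    intro hxy
    have := Polynomial.eval₂_eq_zero_of_dvd_of_eval₂_eq_zero (RingHom.id K) a
      (RatFunc.denom_mul_dvd _ x) hxy
    rw [Polynomial.eval₂_mul, RatFunc.denom_algebraMap] at this
    simp at this
    exact hx this

/-- Membership in `regularSubring a`. (proof step of Prop. 3.5 over all fields,
`AndrewsForbes2022_prop_3_5_of_field`). [cite: AndrewsForbes2022, Prop. 3.5 (proof)] -/
theorem mem_regularSubring_iff {a : K} {x : RatFunc K} :
    x ∈ regularSubring a ↔ Polynomial.eval₂ (RingHom.id K) a (RatFunc.denom x) ≠ 0 := Iff.rfl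

/-- Polynomials are regular everywhere. (proof step of Prop. 3.5 over all fields,
`AndrewsForbes2022_prop_3_5_of_field`). [cite: AndrewsForbes2022, Prop. 3.5 (proof)] -/
theorem algebraMap_mem_regularSubring (a : K) (P : K[X]) :
    algebraMap K[X] (RatFunc K) P ∈ regularSubring a := by
  simp [mem_regularSubring_iff]

/-- `E` is regular everywhere. (proof step of Prop. 3.5 over all fields,
`AndrewsForbes2022_prop_3_5_of_field`). [cite: AndrewsForbes2022, Prop. 3.5 (proof)] -/
theorem X_mem_regularSubring (a : K) : (RatFunc.X : RatFunc K) ∈ regularSubring a := by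
  simp [mem_regularSubring_iff]

/-- Constants are regular everywhere. (proof step of Prop. 3.5 over all fields,
`AndrewsForbes2022_prop_3_5_of_field`). [cite: AndrewsForbes2022, Prop. 3.5 (proof)] -/
theorem C_mem_regularSubring (a c : K) : (RatFunc.C c : RatFunc K) ∈ regularSubring a := by
  simp [mem_regularSubring_iff]

/-- `E⁻¹` is regular away from `0`. (proof step of Prop. 3.5 over all fields,
`AndrewsForbes2022_prop_3_5_of_field`). [cite: AndrewsForbes2022, Prop. 3.5 (proof)] -/
theorem inv_X_mem_regularSubring {a : K} (ha : a ≠ 0) :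
    (RatFunc.X : RatFunc K)⁻¹ ∈ regularSubring a := by
  rw [mem_regularSubring_iff]
  intro h
  have hdvd := RatFunc.denom_inv_dvd (RatFunc.X_ne_zero (K := K))
  rw [RatFunc.num_X] at hdvd
  have := Polynomial.eval₂_eq_zero_of_dvd_of_eval₂_eq_zero (RingHom.id K) a hdvd h
  simp at this
  exact ha this

/-- `E^q` (`q ∈ ℤ`) is regular away from `0`. (proof step of Prop. 3.5 over all fields,
`AndrewsForbes2022_prop_3_5_of_field`). [cite: AndrewsForbes2022, Prop. 3.5 (proof)] -/
theorem X_zpow_mem_regularSubring {a : K} (ha : a ≠ 0) (q : ℤ) :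
    (RatFunc.X : RatFunc K) ^ q ∈ regularSubring a := by
  obtain ⟨k, rfl | rfl⟩ := q.eq_nat_or_neg
  · rw [zpow_natCast]; exact Subring.pow_mem _ (X_mem_regularSubring a) k
  · rw [zpow_neg, zpow_natCast, ← inv_pow]
    exact Subring.pow_mem _ (inv_X_mem_regularSubring ha) k

/-- **Evaluation at `a`** as a ring homomorphism on the functions regular at `a` (Mathlib's
`RatFunc.eval`, which is additive and multiplicative as long as denominators do not vanish).
[folklore] -/
def evalHom (a : K) : regularSubring a →+* K where
  toFun x := RatFunc.eval (RingHom.id K) a (x : RatFunc K)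
  map_one' := RatFunc.eval_one _ _
  map_mul' x y := RatFunc.eval_mul _ _ x.2 y.2
  map_zero' := RatFunc.eval_zero _ _
  map_add' x y := RatFunc.eval_add _ _ x.2 y.2

/-- Unfolding `evalHom`. (proof step of Prop. 3.5 over all fields,
`AndrewsForbes2022_prop_3_5_of_field`). [cite: AndrewsForbes2022, Prop. 3.5 (proof)] -/
theorem evalHom_apply (a : K) (x : regularSubring a) :
    evalHom a x = RatFunc.eval (RingHom.id K) a (x : RatFunc K) := rfl

/-- Evaluation of a constant. (proof step of Prop. 3.5 over all fields,
`AndrewsForbes2022_prop_3_5_of_field`). [cite: AndrewsForbes2022, Prop. 3.5 (proof)] -/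
theorem evalHom_C (a c : K) : evalHom a ⟨RatFunc.C c, C_mem_regularSubring a c⟩ = c := by
  rw [evalHom_apply]; simp

/-- Evaluation of `E`. (proof step of Prop. 3.5 over all fields,
`AndrewsForbes2022_prop_3_5_of_field`). [cite: AndrewsForbes2022, Prop. 3.5 (proof)] -/
theorem evalHom_X (a : K) : evalHom a ⟨RatFunc.X, X_mem_regularSubring a⟩ = a := by
  rw [evalHom_apply]; simp

/-- Evaluation of `E^q`, `q ∈ ℤ`, away from `0`. (proof step of Prop. 3.5 over all fields,
`AndrewsForbes2022_prop_3_5_of_field`). [cite: AndrewsForbes2022, Prop. 3.5 (proof)] -/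
theorem evalHom_X_zpow {a : K} (ha : a ≠ 0) (q : ℤ)
    (h : (RatFunc.X : RatFunc K) ^ q ∈ regularSubring a) :
    evalHom a ⟨RatFunc.X ^ q, h⟩ = a ^ q := by
  have hX : evalHom a ⟨RatFunc.X, X_mem_regularSubring a⟩ = a := evalHom_X a
  have hXi : evalHom a ⟨RatFunc.X⁻¹, inv_X_mem_regularSubring ha⟩ = a⁻¹ := by
    have hmul : (⟨RatFunc.X, X_mem_regularSubring a⟩ : regularSubring a) *
        ⟨RatFunc.X⁻¹, inv_X_mem_regularSubring ha⟩ = 1 := by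
      ext; simp [RatFunc.X_ne_zero]
    have := congrArg (evalHom a) hmul
    rw [map_mul, map_one, hX] at this
    exact eq_inv_of_mul_eq_one_right this
  obtain ⟨k, rfl | rfl⟩ := q.eq_nat_or_neg
  · have : (⟨RatFunc.X ^ (k : ℤ), h⟩ : regularSubring a) =
        ⟨RatFunc.X, X_mem_regularSubring a⟩ ^ k := by
      ext; simp
    rw [this, map_pow, hX, zpow_natCast]
  · have : (⟨RatFunc.X ^ (-(k : ℤ)), h⟩ : regularSubring a) =
        ⟨RatFunc.X⁻¹, inv_X_mem_regularSubring ha⟩ ^ k := by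
      ext; simp
    rw [this, map_pow, hXi, zpow_neg, zpow_natCast, inv_pow]

/-- The structure map `K → K(E)` lands in the functions regular at `a`. [folklore] -/
def constHom (a : K) : K →+* regularSubring a :=
  (algebraMap K (RatFunc K)).codRestrict (regularSubring a) fun c => by
    rw [RatFunc.algebraMap_eq_C]; exact C_mem_regularSubring a c

/-- `constHom` followed by the inclusion is the structure map. (proof step of Prop. 3.5 over all fields,
`AndrewsForbes2022_prop_3_5_of_field`). [cite: AndrewsForbes2022, Prop. 3.5 (proof)] -/
theorem subtype_comp_constHom (a : K) :
    (regularSubring a).subtype.comp (constHom a) = algebraMap K (RatFunc K) := rfl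

/-- Constants evaluate to themselves. (proof step of Prop. 3.5 over all fields,
`AndrewsForbes2022_prop_3_5_of_field`). [cite: AndrewsForbes2022, Prop. 3.5 (proof)] -/
theorem evalHom_comp_constHom (a : K) : (evalHom a).comp (constHom a) = RingHom.id K := by
  refine RingHom.ext fun c => ?_
  rw [RingHom.comp_apply, RingHom.id_apply, evalHom_apply]
  change RatFunc.eval (RingHom.id K) a (algebraMap K (RatFunc K) c) = c
  rw [RatFunc.algebraMap_eq_C]; simp

/-! ### The `X`-adic valuation on `F(ε) = RatFunc F`: polynomials, `X`, constants -/

/-- The `X`-adic valuation of a nonzero polynomial is `exp (- its order of vanishing at 0)`.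
(proof step of Prop. 3.5 over all fields,
`AndrewsForbes2022_prop_3_5_of_field`). [cite: AndrewsForbes2022, Prop. 3.5 (proof)] -/
theorem v_algebraMap_polynomial (P : K[X]) (hP : P ≠ 0) :
    Valued.v (algebraMap K[X] (RatFunc K) P) = exp (-(P.natTrailingDegree : ℤ)) := by
  rw [RatFunc.v_def, IsDedekindDomain.HeightOneSpectrum.valuation_of_algebraMap]
  have key : ∀ n : ℕ, (Polynomial.idealX K).intValuation P ≤ exp (-(n : ℤ)) ↔
      n ≤ P.natTrailingDegree := by
    intro n
    rw [IsDedekindDomain.HeightOneSpectrum.intValuation_le_pow_iff_dvd, Polynomial.idealX_span,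
      Ideal.span_singleton_pow, Ideal.span_singleton_dvd_span_singleton_iff_dvd,
      Polynomial.X_pow_dvd_iff]
    constructor
    · intro h
      by_contra hlt
      exact (Polynomial.trailingCoeff_nonzero_iff_nonzero.mpr hP) (h _ (not_le.mp hlt))
    · intro h d hd
      exact Polynomial.coeff_eq_zero_of_lt_natTrailingDegree (lt_of_lt_of_le hd h)
  have h0 : (Polynomial.idealX K).intValuation P ≠ 0 :=
    IsDedekindDomain.HeightOneSpectrum.intValuation_ne_zero _ _ hP
  apply le_antisymm ((key _).mpr le_rfl)
  rw [← exp_log h0, exp_le_exp]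
  have h1 := (key (P.natTrailingDegree + 1)).not.mpr (by omega)
  rw [← exp_log h0, exp_le_exp, not_le] at h1
  push_cast at h1
  omega

/-- `v(ε) = exp (-1)`. (proof step of Prop. 3.5 over all fields,
`AndrewsForbes2022_prop_3_5_of_field`). [cite: AndrewsForbes2022, Prop. 3.5 (proof)] -/
theorem v_X : Valued.v (RatFunc.X : RatFunc K) = exp (-1 : ℤ) := by
  rw [RatFunc.v_def]; exact Polynomial.valuation_X_eq_neg_one K

/-- `v(ε^n) = exp (-n)`. (proof step of Prop. 3.5 over all fields,
`AndrewsForbes2022_prop_3_5_of_field`). [cite: AndrewsForbes2022, Prop. 3.5 (proof)] -/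
theorem v_X_pow (n : ℕ) : Valued.v ((RatFunc.X : RatFunc K) ^ n) = exp (-(n : ℤ)) := by
  rw [map_pow, v_X, ← exp_nsmul]; simp

/-- `v(ε^n) = exp (-n)`, `n ∈ ℤ`. (proof step of Prop. 3.5 over all fields,
`AndrewsForbes2022_prop_3_5_of_field`). [cite: AndrewsForbes2022, Prop. 3.5 (proof)] -/
theorem v_X_zpow (n : ℤ) : Valued.v ((RatFunc.X : RatFunc K) ^ n) = exp (-n) := by
  rw [map_zpow₀, v_X, ← exp_zsmul]; simp

/-- Constants have valuation `≤ 1`. (proof step of Prop. 3.5 over all fields,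
`AndrewsForbes2022_prop_3_5_of_field`). [cite: AndrewsForbes2022, Prop. 3.5 (proof)] -/
theorem v_C_le_one (c : K) : Valued.v (RatFunc.C c : RatFunc K) ≤ 1 := by
  rw [← RatFunc.algebraMap_C, RatFunc.v_def]
  exact IsDedekindDomain.HeightOneSpectrum.valuation_le_one _ _

/-- The tree's `IsBigOEps` (vanishing of the Laurent coefficients of index `< k`) is the valuation
bound `v ≤ exp (-k)` (Mathlib's `LaurentSeries.valuation_le_iff_coeff_lt_eq_zero`).
[cite: AndrewsForbes2022, Def. 2.1] -/
theorem v_le_exp_iff_coeff (k : ℤ) (g : RatFunc K) :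
    Valued.v g ≤ exp (-k) ↔ ∀ i : ℤ, i < k → (g : LaurentSeries K).coeff i = 0 := by
  rw [← LaurentSeries.valuation_coe_ratFunc, LaurentSeries.valuation_le_iff_coeff_lt_eq_zero]

/-- `IsBigOEps F k g ↔ v g ≤ exp (-k)`. [cite: AndrewsForbes2022, Def. 2.1] -/
theorem isBigOEps_iff_v_le (k : ℤ) (g : RatFunc K) : IsBigOEps K k g ↔ Valued.v g ≤ exp (-k) :=
  (v_le_exp_iff_coeff k g).symm

/-! ### Substituting `E ↦ ε^M`: exact valuations for `M ≫ 0` -/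

/-- For a nonzero polynomial `P(E)` over `F(ε)` and `M ≫ 0`, the valuation of `P(ε^M)` is that of
its trailing term: `v(P_{b₀}) · exp(-b₀ M)`, `b₀` the `E`-order of `P`.  (All other terms
`P_b ε^{bM}`, `b > b₀`, are eventually strictly smaller.)  The substitution-of-powers-of-`ε`
device of [AndrewsForbes2022, Lemmas 2.38–2.39] for the weights `(M, 1)` on `(E, ε)`.
[cite: AndrewsForbes2022, Lemma 2.39 (proof)] -/
theorem eventually_v_eval_X_pow (P : (RatFunc K)[X]) (hP : P ≠ 0) :
    ∀ᶠ M : ℕ in atTop,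
      Valued.v (P.eval ((RatFunc.X : RatFunc K) ^ M)) =
        Valued.v (P.coeff P.natTrailingDegree) * exp (-((P.natTrailingDegree : ℤ) * M)) := by
  set b₀ := P.natTrailingDegree with hb₀def
  have hb₀ : P.coeff b₀ ≠ 0 := Polynomial.trailingCoeff_nonzero_iff_nonzero.mpr hP
  have hvb₀ : Valued.v (P.coeff b₀) ≠ 0 := (Valuation.ne_zero_iff _).mpr hb₀
  have hterm : ∀ (b M : ℕ), P.coeff b ≠ 0 →
      Valued.v (P.coeff b * ((RatFunc.X : RatFunc K) ^ M) ^ b) =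
        exp (log (Valued.v (P.coeff b)) - (b : ℤ) * M) := by
    intro b M hb
    have hvb : Valued.v (P.coeff b) ≠ 0 := (Valuation.ne_zero_iff _).mpr hb
    rw [map_mul, map_pow, v_X_pow, ← exp_nsmul]
    conv_lhs => rw [← exp_log hvb]
    rw [← exp_add, exp_inj, nsmul_eq_mul]
    ring
  have hsmall : ∀ᶠ M : ℕ in atTop, ∀ b ∈ P.support.erase b₀,
      Valued.v (P.coeff b * ((RatFunc.X : RatFunc K) ^ M) ^ b) <
        Valued.v (P.coeff b₀ * ((RatFunc.X : RatFunc K) ^ M) ^ b₀) := by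
    refine (eventually_all_finset _).mpr fun b hb => ?_
    obtain ⟨hbne, hbsupp⟩ := Finset.mem_erase.mp hb
    have hcb : P.coeff b ≠ 0 := Polynomial.mem_support_iff.mp hbsupp
    have hlt : b₀ < b :=
      lt_of_le_of_ne (Polynomial.natTrailingDegree_le_of_ne_zero hcb) (Ne.symm hbne)
    refine (eventually_ge_atTop
      ((log (Valued.v (P.coeff b)) - log (Valued.v (P.coeff b₀))).toNat + 1)).mono fun M hM => ?_
    rw [hterm b M hcb, hterm b₀ M hb₀, exp_lt_exp]
    have h1 : (b₀ : ℤ) + 1 ≤ b := by exact_mod_cast hlt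
    have h2 : log (Valued.v (P.coeff b)) - log (Valued.v (P.coeff b₀)) < (M : ℤ) := by
      have := Int.self_le_toNat (log (Valued.v (P.coeff b)) - log (Valued.v (P.coeff b₀)))
      omega
    nlinarith
  refine hsmall.mono fun M hM => ?_
  rw [Polynomial.eval_eq_sum, Polynomial.sum_def,
    ← Finset.add_sum_erase _ _ (Polynomial.mem_support_iff.mpr hb₀)]
  rw [Valuation.map_add_eq_of_lt_left]
  · rw [hterm b₀ M hb₀, ← exp_log hvb₀, ← exp_add, log_exp, sub_eq_add_neg]
  · refine Valuation.map_sum_lt _ ((Valuation.ne_zero_iff _).mpr ?_) hM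
    exact mul_ne_zero hb₀ (pow_ne_zero _ (pow_ne_zero _ RatFunc.X_ne_zero))

/-- The `E`-order of a rational function over `F(ε)` through its reduced numerator/denominator.
[folklore] -/
def ordE (x : RatFunc (RatFunc K)) : ℤ :=
  ((RatFunc.num x).natTrailingDegree : ℤ) - (RatFunc.denom x).natTrailingDegree

/-- The eventual leading valuation constant of `x(ε^M)`. [folklore] -/
def gam (x : RatFunc (RatFunc K)) : ℤᵐ⁰ :=
  Valued.v ((RatFunc.num x).coeff (RatFunc.num x).natTrailingDegree) /
    Valued.v ((RatFunc.denom x).coeff (RatFunc.denom x).natTrailingDegree)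

/-- `gam x ≠ 0` for `x ≠ 0`. (proof step of Prop. 3.5 over all fields,
`AndrewsForbes2022_prop_3_5_of_field`). [cite: AndrewsForbes2022, Prop. 3.5 (proof)] -/
theorem gam_ne_zero {x : RatFunc (RatFunc K)} (hx : x ≠ 0) : gam x ≠ 0 := by
  have hn : (RatFunc.num x).coeff (RatFunc.num x).natTrailingDegree ≠ 0 :=
    Polynomial.trailingCoeff_nonzero_iff_nonzero.mpr (RatFunc.num_ne_zero hx)
  have hd : (RatFunc.denom x).coeff (RatFunc.denom x).natTrailingDegree ≠ 0 :=
    Polynomial.trailingCoeff_nonzero_iff_nonzero.mpr (RatFunc.denom_ne_zero x)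
  exact div_ne_zero ((Valuation.ne_zero_iff _).mpr hn) ((Valuation.ne_zero_iff _).mpr hd)

/-- For a nonzero rational function `x(E)` over `F(ε)` and `M ≫ 0`: `x` is regular at `ε^M` and
`v(x(ε^M)) = gam x · exp(-(ordE x) M)` — the order in `ε` of the specialisation is `M` times the
order in `E`, up to a constant. [cite: AndrewsForbes2022, Lemma 2.39 (proof)] -/
theorem eventually_regular_and_v_eval (x : RatFunc (RatFunc K)) (hx : x ≠ 0) :
    ∀ᶠ M : ℕ in atTop,
      Polynomial.eval₂ (RingHom.id _) ((RatFunc.X : RatFunc K) ^ M) (RatFunc.denom x) ≠ 0 ∧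
      Valued.v (RatFunc.eval (RingHom.id _) ((RatFunc.X : RatFunc K) ^ M) x) =
        gam x * exp (-(ordE x * M)) := by
  have hn := eventually_v_eval_X_pow (RatFunc.num x) (RatFunc.num_ne_zero hx)
  have hd := eventually_v_eval_X_pow (RatFunc.denom x) (RatFunc.denom_ne_zero x)
  refine (hn.and hd).mono fun M ⟨hM1, hM2⟩ => ?_
  have hdc : (RatFunc.denom x).coeff (RatFunc.denom x).natTrailingDegree ≠ 0 :=
    Polynomial.trailingCoeff_nonzero_iff_nonzero.mpr (RatFunc.denom_ne_zero x)
  have hd0 : Polynomial.eval ((RatFunc.X : RatFunc K) ^ M) (RatFunc.denom x) ≠ 0 := by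
    rw [← (Valuation.ne_zero_iff Valued.v), hM2]
    exact mul_ne_zero ((Valuation.ne_zero_iff _).mpr hdc) exp_ne_zero
  refine ⟨by rwa [Polynomial.eval₂_id], ?_⟩
  rw [RatFunc.eval, Polynomial.eval₂_id, Polynomial.eval₂_id, map_div₀, hM1, hM2, gam, ordE,
    mul_div_mul_comm, ← exp_sub]
  congr 2
  ring

/-- An `O(E^k)` bound in `L((E))` bounds `ordE` from below. [cite: AndrewsForbes2022, Def. 2.1] -/
theorem le_ordE_of_v_le {x : RatFunc (RatFunc K)} (hx : x ≠ 0) {k : ℤ}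
    (hk : Valued.v x ≤ exp (-k)) : k ≤ ordE x := by
  have hnum := v_algebraMap_polynomial (RatFunc.num x) (RatFunc.num_ne_zero hx)
  have hden := v_algebraMap_polynomial (RatFunc.denom x) (RatFunc.denom_ne_zero x)
  rw [← RatFunc.num_div_denom x, map_div₀, hnum, hden, ← exp_sub, exp_le_exp] at hk
  rw [ordE]; linarith

/-! ### The leading `ε`-coefficient of a nonzero element of `F(ε)` -/

/-- `α = α' ε^κ + O(ε^{κ+1})` with `α' ∈ F^×` for every nonzero `α ∈ F(ε)` (order and leading
coefficient of its Laurent expansion). (proof step of Prop. 3.5 over all fields,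
`AndrewsForbes2022_prop_3_5_of_field`). [cite: AndrewsForbes2022, Prop. 3.5 (proof)] -/
theorem exists_leading_coeff (α : RatFunc K) (hα : α ≠ 0) :
    ∃ (κ : ℤ) (α' : K), α' ≠ 0 ∧
      Valued.v (α - RatFunc.X ^ κ * algebraMap K (RatFunc K) α') ≤ exp (-(κ + 1)) := by
  have hα' : (α : LaurentSeries K) ≠ 0 :=
    (map_ne_zero_iff _ (algebraMap (RatFunc K) (LaurentSeries K)).injective).mpr hα
  set A : LaurentSeries K := (α : LaurentSeries K) with hA
  refine ⟨A.order, A.coeff A.order, HahnSeries.coeff_order_eq_zero.not.mpr hα', ?_⟩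
  rw [v_le_exp_iff_coeff]
  intro i hi
  rw [map_sub, map_mul, coe_ratFunc_X_zpow, coe_ratFunc_algebraMap, HahnSeries.C_apply,
    HahnSeries.single_mul_single, add_zero, one_mul, HahnSeries.coeff_sub]
  rcases lt_or_eq_of_le (Int.lt_add_one_iff.mp hi) with hlt | heq
  · rw [HahnSeries.coeff_eq_zero_of_lt_order hlt, HahnSeries.coeff_single_of_ne hlt.ne, sub_zero]
  · rw [heq, HahnSeries.coeff_single_same, sub_self]

/-! ### Small algebra helpers -/

/-- Determinantal ideals are defined over `ℤ`: extension of scalars maps `I^det_{n,m,r}` into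
itself (local copy of the tree's `map_mem_detIdeal`, kept out of the import cone).
[cite: AndrewsForbes2022, §2 (Preliminaries)] -/
theorem map_mem_detIdeal' {F L : Type*} [Field F] [Field L] (φ : F →+* L) {n m r : ℕ}
    {f : MvPolynomial (Fin n × Fin m) F} (hf : f ∈ detIdeal F n m r) :
    MvPolynomial.map φ f ∈ detIdeal L n m r := by
  have h := Ideal.mem_map_of_mem (MvPolynomial.map φ) hf
  rw [detIdeal, Ideal.map_span] at h
  refine (Ideal.span_le.2 ?_) h
  rintro _ ⟨p, ⟨ρ, γ, rfl⟩, rfl⟩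
  refine Ideal.subset_span ⟨ρ, γ, ?_⟩
  change MvPolynomial.map φ _ = _
  rw [RingHom.map_det]
  congr 1
  ext i j
  simp [Matrix.submatrix_apply, Matrix.mvPolynomialX_apply, MvPolynomial.map_X]

/-- `aeval` into polynomials over an algebra is `bind₁` after base change. (proof step of Prop. 3.5 over all fields,
`AndrewsForbes2022_prop_3_5_of_field`). [cite: AndrewsForbes2022, Prop. 3.5 (proof)] -/
theorem aeval_eq_bind₁_map {R A : Type*} [CommSemiring R] [CommSemiring A] [Algebra R A]
    {σ τ : Type*} (g : σ → MvPolynomial τ A) (p : MvPolynomial σ R) :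
    MvPolynomial.aeval g p = MvPolynomial.bind₁ g (MvPolynomial.map (algebraMap R A) p) := by
  rw [MvPolynomial.bind₁, MvPolynomial.aeval_map_algebraMap]

end Prop35AllFields

/-! ### Proposition 3.5 over every field -/

set_option maxHeartbeats 800000 in
open Prop35AllFields in
/-- **Andrews–Forbes 2022, Proposition 3.5, over EVERY field** (all characteristics, finite fields
included): for `0 < r` and a nonzero `f ∈ I^det_{n,m,r} ⊆ F[X]` there are an invertible change of
variables `c` over `F(ε)`, `q ∈ ℤ`, `α ∈ F^×` and a partition `σ` with `σ₁ ≥ r` (parts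
`≤ min(n,m)`) such that `f(c · X) = ε^q α (K_σ|K_σ)(X) + O(ε^{q+1})` — the conclusion of the tree's
`AndrewsForbes2022_prop_3_5` without `[CharZero F]`.  Proof: the tree's theorem over the infinite
field `F(t)` (`AndrewsForbes2022_prop_3_5_of_infinite`) specialised along `t ↦ ε`, `E ↦ ε^M`,
`M ≫ 0` (the leading-coefficient approximation of Lemma 2.39; module docstring).
[cite: AndrewsForbes2022, Prop. 3.5] -/
theorem AndrewsForbes2022_prop_3_5_of_field (F : Type) [Field F] (n m r : ℕ)
    (hr : 0 < r) (f : MvPolynomial (Fin n × Fin m) F)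
    (hf : f ∈ detIdeal F n m r) (hf0 : f ≠ 0) :
    ∃ (c : Matrix (Fin n × Fin m) (Fin n × Fin m) (RatFunc F)) (q : ℤ) (α : F) (σ : Multiset ℕ),
      IsUnit c ∧ α ≠ 0 ∧ r ≤ σ.sup ∧ (∀ s ∈ σ, 0 < s ∧ s ≤ min n m) ∧
      ∀ e : (Fin n × Fin m) →₀ ℕ,
        IsBigOEps F (q + 1) (MvPolynomial.coeff e
          (MvPolynomial.aeval
              (fun ij : Fin n × Fin m =>
                ∑ kl : Fin n × Fin m, MvPolynomial.C (c ij kl) * MvPolynomial.X kl) f -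
            MvPolynomial.C (RatFunc.X ^ q * algebraMap F (RatFunc F) α) *
              MvPolynomial.map (algebraMap F (RatFunc F)) (kBideterminant F n m σ))) := by
  classical
  -- ### Step A: base change to the infinite field `L = F(t)` and the tree's Prop. 3.5 there
  haveI : Infinite (RatFunc F) :=
    Infinite.of_injective (algebraMap F[X] (RatFunc F)) (IsFractionRing.injective _ _)
  have hfL0 : MvPolynomial.map (algebraMap F (RatFunc F)) f ≠ 0 := fun h =>
    hf0 (MvPolynomial.map_injective _ (algebraMap F (RatFunc F)).injective
      (by rw [h, map_zero]))
  obtain ⟨c, q, α, σ, hcU, hα, hσr, hσb, hbig⟩ :=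
    AndrewsForbes2022_prop_3_5_of_infinite (RatFunc F) n m r hr
      (MvPolynomial.map (algebraMap F (RatFunc F)) f) (map_mem_detIdeal' _ hf) hfL0
  -- notation: `L = F(ε)`, `RL = L(E)`
  set g : Fin n × Fin m → MvPolynomial (Fin n × Fin m) (RatFunc (RatFunc F)) :=
    fun ij => ∑ kl : Fin n × Fin m, MvPolynomial.C (c ij kl) * MvPolynomial.X kl with hgdef
  set Δ : MvPolynomial (Fin n × Fin m) (RatFunc (RatFunc F)) :=
    MvPolynomial.aeval g (MvPolynomial.map (algebraMap F (RatFunc F)) f) -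
      MvPolynomial.C (RatFunc.X ^ q * algebraMap (RatFunc F) (RatFunc (RatFunc F)) α) *
        MvPolynomial.map (algebraMap (RatFunc F) (RatFunc (RatFunc F)))
          (kBideterminant (RatFunc F) n m σ) with hΔdef
  -- the leading `ε`-coefficient of `α ∈ F(ε)^×`
  obtain ⟨κ, α', hα', hαv⟩ := exists_leading_coeff α hα
  have hdet0 : c.det ≠ 0 := ((Matrix.isUnit_iff_isUnit_det c).mp hcU).ne_zero
  -- ### Step B: `M ≫ 0`
  have hA : ∀ᶠ M : ℕ in atTop, ∀ p : (Fin n × Fin m) × (Fin n × Fin m),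
      Polynomial.eval₂ (RingHom.id (RatFunc F)) ((RatFunc.X : RatFunc F) ^ M)
        (RatFunc.denom (c p.1 p.2)) ≠ 0 := by
    refine eventually_all.mpr fun p => ?_
    by_cases h0 : c p.1 p.2 = 0
    · refine Eventually.of_forall fun M => ?_
      rw [h0, RatFunc.denom_zero]; simp
    · exact (eventually_regular_and_v_eval _ h0).mono fun M hM => hM.1
  have hB : ∀ᶠ M : ℕ in atTop,
      RatFunc.eval (RingHom.id (RatFunc F)) ((RatFunc.X : RatFunc F) ^ M) c.det ≠ 0 :=
    (eventually_regular_and_v_eval _ hdet0).mono fun M hM => by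
      rw [← (Valuation.ne_zero_iff Valued.v), hM.2]
      exact mul_ne_zero (gam_ne_zero hdet0) exp_ne_zero
  have hC : ∀ᶠ M : ℕ in atTop, ∀ e ∈ Δ.support,
      Valued.v (RatFunc.eval (RingHom.id (RatFunc F)) ((RatFunc.X : RatFunc F) ^ M) (MvPolynomial.coeff e Δ)) =
        gam (MvPolynomial.coeff e Δ) * exp (-(ordE (MvPolynomial.coeff e Δ) * M)) :=
    (eventually_all_finset _).mpr fun e he =>
      (eventually_regular_and_v_eval _ (MvPolynomial.mem_support_iff.mp he)).mono fun M hM => hM.2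
  have hD : ∀ᶠ M : ℕ in atTop, ∀ e ∈ Δ.support, log (gam (MvPolynomial.coeff e Δ)) + κ + 1 ≤ (M : ℤ) :=
    (eventually_all_finset _).mpr fun e _ =>
      tendsto_natCast_atTop_atTop.eventually (eventually_ge_atTop _)
  obtain ⟨M, hMA, hMB, hMC, hMD⟩ := (hA.and (hB.and (hC.and hD))).exists
  -- ### Step C: the specialisation `E ↦ ε^M` on the functions regular there
  set a : RatFunc F := (RatFunc.X : RatFunc F) ^ M with hadef
  have ha0 : a ≠ 0 := pow_ne_zero _ RatFunc.X_ne_zero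
  let R := regularSubring a
  let π : R →+* RatFunc F := evalHom a
  let j : RatFunc F →+* R := constHom a
  have hπj : ∀ x, π (j x) = x := fun x => by
    change ((evalHom a).comp (constHom a)) x = x
    rw [evalHom_comp_constHom]; rfl
  let cR : Matrix (Fin n × Fin m) (Fin n × Fin m) R := fun ij kl => ⟨c ij kl, hMA (ij, kl)⟩
  have hcR : cR.map R.subtype = c := by ext ij kl; rfl
  let c' : Matrix (Fin n × Fin m) (Fin n × Fin m) (RatFunc F) := cR.map π
  let gR : Fin n × Fin m → MvPolynomial (Fin n × Fin m) R :=
    fun ij => ∑ kl : Fin n × Fin m, MvPolynomial.C (cR ij kl) * MvPolynomial.X kl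
  let tR : R := ⟨RatFunc.X ^ q, X_zpow_mem_regularSubring ha0 q⟩ * j α
  let ΔR : MvPolynomial (Fin n × Fin m) R :=
    MvPolynomial.bind₁ gR (MvPolynomial.map (j.comp (algebraMap F (RatFunc F))) f) -
      MvPolynomial.C tR * MvPolynomial.map (j.comp (algebraMap F (RatFunc F))) (kBideterminant F n m σ)
  -- `ΔR` is `Δ` (inclusion side)
  have h2 : R.subtype.comp (j.comp (algebraMap F (RatFunc F))) =
      (algebraMap (RatFunc F) (RatFunc (RatFunc F))).comp (algebraMap F (RatFunc F)) := rfl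
  have hsub : MvPolynomial.map R.subtype ΔR = Δ := by
    have h1 : (fun ij => MvPolynomial.map R.subtype (gR ij)) = g := funext fun ij => by
      simp only [gR, g, map_sum, map_mul, MvPolynomial.map_C, MvPolynomial.map_X]
      rfl
    have hG : MvPolynomial.map R.subtype
        (MvPolynomial.bind₁ gR (MvPolynomial.map (j.comp (algebraMap F (RatFunc F))) f)) =
        MvPolynomial.aeval g (MvPolynomial.map (algebraMap F (RatFunc F)) f) := by
      rw [MvPolynomial.map_bind₁, h1, MvPolynomial.map_map, h2, aeval_eq_bind₁_map,
        MvPolynomial.map_map]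
    have htR : R.subtype tR =
        RatFunc.X ^ q * algebraMap (RatFunc F) (RatFunc (RatFunc F)) α := by
      simp only [tR, map_mul]; rfl
    have hT : MvPolynomial.map R.subtype (MvPolynomial.C tR *
        MvPolynomial.map (j.comp (algebraMap F (RatFunc F))) (kBideterminant F n m σ)) =
        MvPolynomial.C (RatFunc.X ^ q * algebraMap (RatFunc F) (RatFunc (RatFunc F)) α) *
          MvPolynomial.map (algebraMap (RatFunc F) (RatFunc (RatFunc F)))
            (kBideterminant (RatFunc F) n m σ) := by
      rw [map_mul, MvPolynomial.map_C, htR, MvPolynomial.map_map, h2, ← MvPolynomial.map_map,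
        Theorem38.map_kBideterminant]
    simp only [ΔR, Δ, map_sub, hG, hT]
  -- `ΔR` specialises to the new change of variables (evaluation side)
  have h2π : π.comp (j.comp (algebraMap F (RatFunc F))) = algebraMap F (RatFunc F) := by
    refine RingHom.ext fun x => ?_
    simp only [RingHom.comp_apply, hπj]
  have hπ : MvPolynomial.map π ΔR =
      MvPolynomial.aeval (fun ij : Fin n × Fin m =>
          ∑ kl : Fin n × Fin m, MvPolynomial.C (c' ij kl) * MvPolynomial.X kl) f -
        MvPolynomial.C (a ^ q * α) *
          MvPolynomial.map (algebraMap F (RatFunc F)) (kBideterminant F n m σ) := by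
    have h1 : (fun ij => MvPolynomial.map π (gR ij)) = fun ij : Fin n × Fin m =>
        ∑ kl : Fin n × Fin m, MvPolynomial.C (c' ij kl) * MvPolynomial.X kl := funext fun ij => by
      simp only [gR, c', map_sum, map_mul, MvPolynomial.map_C, MvPolynomial.map_X]
      rfl
    have h3 : π tR = a ^ q * α := by
      change evalHom a (⟨RatFunc.X ^ q, X_zpow_mem_regularSubring ha0 q⟩ * j α) = _
      rw [map_mul, evalHom_X_zpow ha0 q]
      exact congrArg (a ^ q * ·) (hπj α)
    have hG : MvPolynomial.map π
        (MvPolynomial.bind₁ gR (MvPolynomial.map (j.comp (algebraMap F (RatFunc F))) f)) =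
        MvPolynomial.aeval (fun ij : Fin n × Fin m =>
          ∑ kl : Fin n × Fin m, MvPolynomial.C (c' ij kl) * MvPolynomial.X kl) f := by
      rw [MvPolynomial.map_bind₁, h1, MvPolynomial.map_map, h2π, aeval_eq_bind₁_map]
    have hT : MvPolynomial.map π (MvPolynomial.C tR *
        MvPolynomial.map (j.comp (algebraMap F (RatFunc F))) (kBideterminant F n m σ)) =
        MvPolynomial.C (a ^ q * α) *
          MvPolynomial.map (algebraMap F (RatFunc F)) (kBideterminant F n m σ) := by
      rw [map_mul, MvPolynomial.map_C, h3, MvPolynomial.map_map, h2π]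
    simp only [ΔR, map_sub, hG, hT]
  -- ### Step D: the witnesses over `F`
  refine ⟨c', q * M + κ, α', σ, ?_, hα', hσr, hσb, fun e => ?_⟩
  · -- invertibility: `det c' = (det c)(ε, ε^M) ≠ 0`
    rw [Matrix.isUnit_iff_isUnit_det, isUnit_iff_ne_zero]
    have hd : c'.det = π cR.det := by
      rw [RingHom.map_det, RingHom.mapMatrix_apply]
    have hd' : (cR.det : RatFunc (RatFunc F)) = c.det := by
      rw [← hcR, ← RingHom.mapMatrix_apply, ← RingHom.map_det]; rfl
    rw [hd]
    change RatFunc.eval (RingHom.id (RatFunc F)) a (cR.det : RatFunc (RatFunc F)) ≠ 0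
    rw [hd']
    exact hMB
  · -- the `O(ε^{qM+κ+1})` estimate, coefficient by coefficient
    rw [isBigOEps_iff_v_le]
    have hX0 : (RatFunc.X : RatFunc F) ≠ 0 := RatFunc.X_ne_zero
    -- rewrite the target polynomial as `map π ΔR + C(a^q (α - ε^κ α')) · K_σ`
    have htgt : MvPolynomial.aeval (fun ij : Fin n × Fin m =>
          ∑ kl : Fin n × Fin m, MvPolynomial.C (c' ij kl) * MvPolynomial.X kl) f -
        MvPolynomial.C (RatFunc.X ^ (q * M + κ) * algebraMap F (RatFunc F) α') *
          MvPolynomial.map (algebraMap F (RatFunc F)) (kBideterminant F n m σ) =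
        MvPolynomial.map π ΔR +
          MvPolynomial.C (a ^ q * (α - RatFunc.X ^ κ * algebraMap F (RatFunc F) α')) *
            MvPolynomial.map (algebraMap F (RatFunc F)) (kBideterminant F n m σ) := by
      rw [hπ]
      have haq : a ^ q * (RatFunc.X ^ κ * algebraMap F (RatFunc F) α') =
          RatFunc.X ^ (q * M + κ) * algebraMap F (RatFunc F) α' := by
        rw [← mul_assoc, hadef, ← zpow_natCast, ← zpow_mul, ← zpow_add₀ hX0, mul_comm (M : ℤ) q]
      rw [mul_sub, haq, map_sub MvPolynomial.C]
      ring
    rw [htgt, MvPolynomial.coeff_add, MvPolynomial.coeff_C_mul, MvPolynomial.coeff_map]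
    -- the bound `exp (-(qM + κ + 1))`
    refine Valuation.map_add_le _ ?_ ?_
    · -- the specialised error term
      by_cases he : MvPolynomial.coeff e Δ = 0
      · have h'' : MvPolynomial.coeff e ΔR = 0 := by
          rw [← hsub, MvPolynomial.coeff_map] at he
          exact (map_eq_zero_iff R.subtype Subtype.val_injective).mp he
        rw [h'', map_zero, Valuation.map_zero]; exact zero_le
      · have hes : e ∈ Δ.support := MvPolynomial.mem_support_iff.mpr he
        have hval : Valued.v (π (MvPolynomial.coeff e ΔR)) =
            gam (MvPolynomial.coeff e Δ) * exp (-(ordE (MvPolynomial.coeff e Δ) * M)) := by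
          rw [← hMC e hes]
          change Valued.v (RatFunc.eval (RingHom.id (RatFunc F)) a ↑(MvPolynomial.coeff e ΔR)) = _
          rw [← hsub, MvPolynomial.coeff_map]; rfl
        have hord : q + 1 ≤ ordE (MvPolynomial.coeff e Δ) :=
          le_ordE_of_v_le he ((isBigOEps_iff_v_le _ _).mp (hbig e))
        have hMge := hMD e hes
        rw [hval, ← exp_log (gam_ne_zero he), ← exp_add, exp_le_exp]
        have hM0 : (0 : ℤ) ≤ M := Int.natCast_nonneg M
        have hprod := mul_le_mul_of_nonneg_right hord hM0
        linarith
    · -- the main term `ε^{Mq} (α - ε^κ α') (K_σ)_e`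
      rw [map_mul, map_mul]
      have h1 : Valued.v (a ^ q) = exp (-(q * M)) := by
        rw [hadef, ← zpow_natCast, ← zpow_mul, v_X_zpow, mul_comm]
      have h3 : Valued.v (algebraMap F (RatFunc F) (MvPolynomial.coeff e (kBideterminant F n m σ))) ≤ 1 := by
        rw [RatFunc.algebraMap_eq_C]; exact v_C_le_one _
      calc Valued.v (a ^ q) * Valued.v (α - RatFunc.X ^ κ * algebraMap F (RatFunc F) α') *
            Valued.v (algebraMap F (RatFunc F) (MvPolynomial.coeff e (kBideterminant F n m σ)))
          ≤ exp (-(q * M)) * exp (-(κ + 1)) * 1 := by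
            rw [h1]
            exact mul_le_mul' (mul_le_mul' le_rfl hαv) h3
        _ = exp (-(q * ↑M + κ + 1)) := by rw [mul_one, ← exp_add]; congr 1; ring

/-! ### Theorem 3.8 in characteristic `p`: the discharge -/

/-- **Discharge of `AndrewsForbes2022_thm_3_8_posChar`** (AF22 Thm. 3.8, third bullet, for every
field of characteristic `p > 0`, finite fields included): the tree's reduction
`AndrewsForbes2022_thm_3_8_posChar_of` (the printed char-`p` argument, p0024:L40–L45) fed with
Prop. 3.5 over every field (`AndrewsForbes2022_prop_3_5_of_field`).
[cite: AndrewsForbes2022, Thm. 3.8 (third bullet)] -/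
theorem AndrewsForbes2022_thm_3_8_posChar_holds : AndrewsForbes2022_thm_3_8_posChar :=
  AndrewsForbes2022_thm_3_8_posChar_of fun _ _ F _ _ n m r hr _ f hf hf0 =>
    AndrewsForbes2022_prop_3_5_of_field F n m r hr f hf hf0

end Literature.Computability.AlgebraicComplexity
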